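import Summits.BirchSwinnertonDyer.BirchSwinnertonDyer.Theorems.GenusKolyvaginAtTwoPowDvdShaCardAtTwoRTCrossPairTerm
import Summits.BirchSwinnertonDyer.BirchSwinnertonDyer.Theorems.GenusKolyvaginAtTwoPowDvdShaCardAtTwoRTCrossPairProvenancePrelims
import Summits.BirchSwinnertonDyer.BirchSwinnertonDyer.Theorems.GenusKolyvaginAtTwoPowDvdShaCardAtTwoRTTwoTermIdentityKolyvagin
import Summits.BirchSwinnertonDyer.BirchSwinnertonDyer.Theorems.GenusKolyvaginAtTwoVisiblePairAtTwoKolyvaginClassSign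
import Summits.BirchSwinnertonDyer.BirchSwinnertonDyer.Theorems.GenusKolyvaginAtTwoVisiblePairAtTwoCasselsTateValue
import Summits.BirchSwinnertonDyer.BirchSwinnertonDyer.Theorems.Rank1ResidualJetConjActPlaceUnramified
import Summits.BirchSwinnertonDyer.BirchSwinnertonDyer.Theorems.Rank1ResidualJetSelmerLemmas
import Summits.BirchSwinnertonDyer.Rank1Residual.P2.CMKolyvaginTamagawaSelmerAtTwo
import Literature.NumberTheory.EllipticCurves.TwoTorsionOddDegreeBaseChangeProofs
import Literature.NumberTheory.EllipticCurves.HeegnerPointsKolyvaginExceptionalSelmerProofs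
import HarnessLib

/-!
# Route `GenusKolyvaginAtTwo`, crux L_T `PowDvdShaCardAtTwoRT` (stmt-BirchSwinnertonDyer-23299), LINE 18, road (E4) — the X-ORTH
# ADAPTER: gk2-p4's one-pair theorem INSTANTIATED on the LINE's Kolyvagin classes, in the PROVENANCE currency of gk2-p2's capstone

Seat `bsd-line-gk2-p5` g27 (WIDTH-5 attach, SUPPLY lineage, cell `bsd-f1-sign2`), `--supports` the crux L_T (helper; closes nothing).
THEOREMS ONLY (no definition, no named fact, no `sorry`); BSD is not proved by any of this; neither is L_T nor any stub.

WHY.  Road (E4) (gk2-p4 memo `Cruxes/PowDvdShaCardAtTwoRT/Lines/plus-descent-deep-orthogonality-gk2p4.md` §4, §8): L_T's conclusion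
`2^{2M₀} ∣ #Ш(E_K)[2^∞]` follows K-side from Kolyvagin's depth supplies (KS) and ONE socket, X-ORTH — the level-`2^k` Cassels–Tate pairing
of a (+)-provenance and a (−)-provenance Kolyvagin Ш-class VANISHES — through gk2-p2's capstone
`pow_dvd_natCard_sha_of_depth_supplies_of_orthogonal` (p737508).  gk2-p4's `ctLevelPairing_pullback_eq_zero_of_opposite_signs` (p737900)
is X-ORTH for ONE PAIR in abstract currency (a class `c` Selmer off a set of places `Sn`, `z = m • k • c`, `t` with `m • t = 0`, signs
`s` / `−s`, own-place data, a map `ι : Sel^{(m²)} → Ш[m]`).  This file is the plumbing from the LINE's data to that theorem: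

* §1 `ctLevelPairing_eq_zero_of_opposite_signs_of_level_eq` — the one-pair theorem `ι`-FREE (pairs `x x′ : Ш[m]` with
  `shaTorsionVal x = torsionH1ToH1 z`; no global `ι` exists unless `m` kills the image of `Sel^{(m²)}` in `Ш`) and with the CLASS LEVEL a
  free `N` (`hNm : N = m·m`): the capstone frame types its classes at `((2^L : ℕ) : ℤ)`, the Cassels–Tate side at `((m·m : ℕ) : ℤ)`,
  `m = 2^k`, and `2^(2k)` is not syntactically `2^k·2^k` — with `N` free the bridge is `subst`, no class is ever cast.  Proof = gk2-p4's,
  over the `ι`-free vanishing form `ctLevelPairing_eq_zero_of_forall_cases'` (`…CrossPairProvenancePrelims`).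
* §2 `ctLevelPairing_eq_zero_of_kolyvaginClass_of_opposite_sign` — INSTANTIATION on a Kolyvagin class, ORDERED form: first class
  `z = 2^{L−e₁}•c_L(n)` (`n` square-free, primes Zhang–Kolyvagin with `L ≤ M(ℓ)` and `FrobEqFrobInfty W K (2^L) ℓ`, `e₁ ≤ k`, `L = 2k`),
  Selmer and own-vanishing as recorded by the provenance; second class `t` Selmer, `2^k • t = 0`, vanishing at the places over a
  square-free `n′` of Zhang–Kolyvagin primes with `L ≤ M(ℓ)`, and `τ_* t = −(ε_n • t)` for the TRUE sign `ε_n = −w(E)(−1)^{#n}` of `c_L(n)`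
  (Gross Prop. 5.4).  The abstract hypotheses are discharged by: `c_L(n)` Selmer off `n` at EVERY place (Gross Prop. 6.2 (1) with odd
  Tamagawa, `TamagawaSelmerAtTwo.kolyvaginClass_mem_selmerLocalKer_two_pow_of_not_mem`; complex places
  `mem_selmerLocalKer_infinitePlace_of_isImaginaryQuadratic`), own-vanishing (`mem_torsionLocalKer_iff_res_eq_zero`), `E[2^L] ⊂ E(K_λ′)`
  (`JET.GlobalDuality.galoisRep_toLocal_apply_eq_self`, index `≥ L`), `τ • λ = λ` (`smul_place_eq_of_zhangKolyvaginPrime`), ONE Weil datum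
  lift-equivariant at every place (the last conjunct of `JET.GlobalDuality.exists_weilPairing_liftEquivariant` is uniform in the lift),
  `E(K̄)[2^k]^{Γ_K} = 0` (`ρ̄_{E,2}` onto, `K` quadratic: Dokchitser–Dokchitser + `geomTorsion_fixed_eq_zero_of_forall_two_nsmul`).
The companion `…RTCrossPairProvenanceSocket` turns §2 into the symmetric statement in the capstone's own currency (recorded signs of
the ELEMENTS `z`, `z′`; the `2`-torsion dichotomy + antisymmetry) and into the socket `hOrth` of gk2-p2's frame (p737814) literally.

References: [McCallumLMS1991] §4 Lemma 4.3, Prop. 4.4, Prop. 4.7, §5 Lemma 5.3, Thm. 5.4; [GrossLMS1991] §3, Prop. 5.4, Prop. 6.2;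
[MilneADT2006] I §6 proof of Prop. 6.9; [Kolyvagin1991StructureSha]; [DokchitserDokchitserMathZ2012] Thm. (1).
-/

set_option autoImplicit false

noncomputable section

open scoped Classical
open scoped AddSubgroup
open Function Field NumberField IsDedekindDomain WeierstrassCurve
open Literature.NumberTheory.EllipticCurves Literature.NumberTheory.GaloisRepresentations
open Literature.NumberTheory.EllipticCurves.ModularForms
open Literature.NumberTheory.GaloisCohomology
open Literature.NumberTheory.Automorphic
open Summit.BirchSwinnertonDyer.Rank1Residual.X11b.Relaxation
open Summit.BirchSwinnertonDyer.Rank1Residual.JET.GlobalDuality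
open Summit.BirchSwinnertonDyer.Rank1Residual

-- the Theorems namespace of this sub repeats the summit name by design (D-0017 nested layout)
set_option linter.dupNamespace false

namespace Summit.BirchSwinnertonDyer.BirchSwinnertonDyer.Theorems.GenusExact.PlusDescent

variable (W : WeierstrassCurve ℚ) (K : Type) [Field K] [NumberField K] [W.IsElliptic] [W.IsGloballyMinimal]

/-! ## §1 The one-pair theorem, `ι`-free and with the class level a free `N` -/

section LevelBridge

/-- **X-ORTH FOR ONE PAIR, `ι`-free, class level `N = m·m` free.**  gk2-p4's `ctLevelPairing_pullback_eq_zero_of_opposite_signs` with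
(i) the pair given as ELEMENTS `x x′ ∈ Ш(E_K)[m]` over classes `z, t` (`shaTorsionVal x = torsionH1ToH1 z`, `shaTorsionVal x′ =
torsionH1ToH1 t`) instead of through a global `ι : Sel^{(m²)} → Ш[m]`, and (ii) the classes `z = m • k • c`, `t` typed at a level
`((N : ℕ) : ℤ)` with `N = m·m` supplied as an EQUATION (so that a consumer whose classes live at `2^L`, `L = 2k`, `m = 2^k`, applies it
with `N := 2^L`).  Hypotheses otherwise verbatim: `c` Selmer off `Sn` at every place, `m • loc_q (k • c) = 0` on `Sn`, `loc_q t = 0` and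
`E[N] ⊂ E(K_q)` on `Sn′`, every `q ∈ Sn ∖ Sn′` a deep inert Kolyvagin place (`M ≤ M(ℓ)`, `FrobEqFrobInfty W K (2^M) ℓ`, `m·m = 2^M`,
`τ • q = q`, `e` lift-equivariant), signs `τ_* (k•c) = s•(k•c)`, `τ_* t = −(s•t)`, `E(K̄)[m]^{Γ_K} = 0`.  Conclusion: `B_m(x, x′) = 0`.
[cite: McCallumLMS1991, §4 Prop. 4.7, §5 Lemma 5.3, Thm. 5.4] [cite: MilneADT2006, Ch. I §6, proof of Prop. 6.9] -/
theorem ctLevelPairing_eq_zero_of_opposite_signs_of_level_eq {m M N : ℕ} [NeZero m] [NeZero (m * m)]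
    (hNm : N = m * m) (hmm : m * m = 2 ^ M)
    (hK : IsImaginaryQuadratic K) (hΔ : W.Δ < 0) (hM : 1 ≤ M) {τ : K ≃ₐ[ℚ] K} (hτ1 : τ ≠ 1) (hττ : τ * τ = 1)
    (e : (W.baseChange K).geomTorsion ((m * m : ℕ) : ℤ) → (W.baseChange K).geomTorsion ((m * m : ℕ) : ℤ) → AlgebraicClosure K)
    (hμ : ∀ S T, e S T ^ (m * m) = 1)
    (hadd₁ : ∀ S₁ S₂ T, e (S₁ + S₂) T = e S₁ T * e S₂ T)
    (hadd₂ : ∀ S T₁ T₂, e S (T₁ + T₂) = e S T₁ * e S T₂)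
    (hgal : ∀ (γ : absoluteGaloisGroup K) (S T : (W.baseChange K).geomTorsion ((m * m : ℕ) : ℤ)), γ • e S T = e (γ • S) (γ • T))
    (halt : ∀ T, e T T = 1)
    (inv : LocalInvariants K (m * m)) (hinvc : inv.IsConjCompatible τ) (hPT' : inv.SumInvLocalizationEqZero)
    (hH3 : ∀ c₃ : galoisCohomology (DiscreteGaloisModule.mu K (m * m)) 3,
      (∀ v : Place K, galoisCohomology.localization (DiscreteGaloisModule.mu K (m * m)) v 3 c₃ = 0) → c₃ = 0)
    (hfin : ∀ D : GeneralCaseData (W.baseChange K) m e hμ hadd₁ hadd₂ hgal, ∃ S : Finset (Place K), ∀ v ∉ S, D.localTerm inv v = 0)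
    (hnofix : ∀ P : geomTorsion (W.baseChange K) (m : ℤ), (∀ g : absoluteGaloisGroup K, g • P = P) → P = 0)
    (x x' : ((W.baseChange K).sha)[m])
    {z t : galH1Torsion (W.baseChange K) ((N : ℕ) : ℤ)}
    {c : galoisCohomology ((W.baseChange K).torsionGaloisModule ((N : ℕ) : ℤ)) 1}
    (hzS : z ∈ selmerGroup (W.baseChange K) ((N : ℕ) : ℤ)) (htS : t ∈ selmerGroup (W.baseChange K) ((N : ℕ) : ℤ))
    (hx : shaTorsionVal (W.baseChange K) m x = torsionH1ToH1 (W.baseChange K) ((N : ℕ) : ℤ) z)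
    (hx' : shaTorsionVal (W.baseChange K) m x' = torsionH1ToH1 (W.baseChange K) ((N : ℕ) : ℤ) t)
    (k : ℤ) (hz : z = (m : ℤ) • k • c) (hmt : (m : ℤ) • t = 0)
    {s : ℤ} (hsc : conjAct W τ ((N : ℕ) : ℤ) (k • c) = s • (k • c))
    (hst : conjAct W τ ((N : ℕ) : ℤ) t = -(s • t))
    (Sn Sn' : Set (HeightOneSpectrum (𝓞 K)))
    (hc : ∀ v : Place K, (∀ q ∈ Sn, v ≠ Sum.inr q) → c ∈ selmerLocalKer (W.baseChange K) (Place.Completion v) ((N : ℕ) : ℤ))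
    (hmc : ∀ q ∈ Sn, (m : ℤ) • galoisCohomology.localization ((W.baseChange K).torsionGaloisModule ((N : ℕ) : ℤ))
      (Sum.inr q : Place K) 1 (k • c) = 0)
    (ht0 : ∀ q ∈ Sn', galoisCohomology.res ((W.baseChange K).torsionGaloisModule ((N : ℕ) : ℤ))
      (Place.Completion (Sum.inr q : Place K)) 1 t = 0)
    (htriv : ∀ q ∈ Sn', ∀ (g : absoluteGaloisGroup (Place.Completion (Sum.inr q : Place K)))
      (Q : geomTorsion (W.baseChange K) ((N : ℕ) : ℤ)), absGaloisRestrict K (Place.Completion (Sum.inr q : Place K)) g • Q = Q)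
    (hcross : ∀ q ∈ Sn, q ∉ Sn' → ∃ (ℓ : ℕ) (hfix : τ • q = q), Zhang2014.IsKolyvaginPrime (W.conductorNorm ℤ) W K 2 ℓ ∧
      M ≤ Zhang2014.kolyvaginIndex W 2 ℓ ∧ FrobEqFrobInfty W K (2 ^ M) ℓ ∧ (ℓ : 𝓞 K) ∈ q.asIdeal ∧
      ∀ S T, e ((isLiftOfAut_liftAutPlace τ hfix).torsionMap W ((m * m : ℕ) : ℤ) S)
        ((isLiftOfAut_liftAutPlace τ hfix).torsionMap W ((m * m : ℕ) : ℤ) T) = liftAutPlace τ hfix (e S T)) :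
    ctLevelPairing (W.baseChange K) m e hμ hadd₁ hadd₂ hgal inv halt hPT' hH3 hfin x x' = 0 := by
  subst hNm
  -- first-case data for the pair
  obtain ⟨D, hD₁, hDt⟩ := exists_firstCaseData_kolyvagin (⟨z, hzS⟩ : selmerGroup (W.baseChange K) ((m * m : ℕ) : ℤ))
    ⟨t, htS⟩ c k hz hnofix hmt
  refine ctLevelPairing_eq_zero_of_forall_cases' e hμ hadd₁ hadd₂ hgal inv halt hPT' hH3 hfin x x' hx hx' hz D hD₁ hDt
    fun v ↦ ?_
  by_cases hv' : ∃ q ∈ Sn', v = Sum.inr q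
  · -- own place of `t`: `loc_v b′ = 0`
    obtain ⟨q, hq, rfl⟩ := hv'
    exact Or.inr (Or.inl (D.res_b'_eq_zero_of_map_inclKD_eq hDt (ht0 q hq)
      (map_inclKD_restrictField_injective_of_forall_smul_eq (W.baseChange K) m (Place.Completion (Sum.inr q : Place K))
        (htriv q hq))))
  by_cases hv : ∃ q ∈ Sn, v = Sum.inr q
  · -- cross place: `q ∈ Sn ∖ Sn′`
    obtain ⟨q, hq, rfl⟩ := hv
    have hq' : q ∉ Sn' := fun h ↦ hv' ⟨q, h, rfl⟩
    obtain ⟨ℓ, hfix, hℓ, hk, hF, hw, hte⟩ := hcross q hq hq'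
    refine Or.inr (Or.inr ?_)
    have hb₁ : conjAct W τ ((m * m : ℕ) : ℤ) D.b₁ = s • D.b₁ := by rw [hD₁]; exact hsc
    have hmb₁ : (m : ℤ) • galoisCohomology.localization ((W.baseChange K).torsionGaloisModule ((m * m : ℕ) : ℤ))
        (Sum.inr q : Place K) 1 D.b₁ = 0 := by rw [hD₁]; exact hmc q hq
    exact firstCase_localTerm_eq_zero_of_cross_of_sign_inclKD W K hmm hK hΔ hM hℓ hk hF q hw hτ1 hττ hfix e hμ hadd₁ hadd₂ hgal
      halt hte inv hinvc hnofix D hb₁ hmb₁ hDt hst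
  · -- `b₁` is Selmer (Kummer) here
    push Not at hv hv'
    refine Or.inl ?_
    have hcv : c ∈ selmerLocalKer (W.baseChange K) (Place.Completion v) ((m * m : ℕ) : ℤ) := hc v fun q hq h ↦ hv q hq h
    rw [map_zsmul]
    exact AddSubgroup.zsmul_mem _ (mem_kummerLocalConditionAt_res_of_mem_selmerLocalKer (W.baseChange K) _ _ hcv) k

end LevelBridge

/-! ## §2 Instantiation on a Kolyvagin class — ordered form (the first class owns the cross places) -/

section Ordered

/-- `2^{L−e} = 2^k · 2^{k−e}` for `L = 2k`, `e ≤ k`, as integers. [folklore] -/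
theorem natCast_two_pow_sub_eq_mul {L k e : ℕ} (hLk : L = 2 * k) (he : e ≤ k) :
    ((2 ^ (L - e) : ℕ) : ℤ) = ((2 ^ k : ℕ) : ℤ) * ((2 ^ (k - e) : ℕ) : ℤ) := by
  subst hLk
  rw [← Nat.cast_mul, ← pow_add]
  congr 2
  omega

/-- `2^k • (2^{L−e} • c) = 0` in an abelian group in which `2^L • c = 0`, for `L = 2k`, `e ≤ k`. [folklore] -/
theorem two_pow_smul_two_pow_sub_smul_eq_zero {A : Type*} [AddCommGroup A] {L k e : ℕ} (hLk : L = 2 * k) (he : e ≤ k)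
    {c : A} (hc : ((2 ^ L : ℕ) : ℤ) • c = 0) :
    ((2 ^ k : ℕ) : ℤ) • (((2 ^ (L - e) : ℕ) : ℤ) • c) = 0 := by
  subst hLk
  have h : ((2 ^ k : ℕ) : ℤ) * ((2 ^ (2 * k - e) : ℕ) : ℤ) = ((2 ^ (k - e) : ℕ) : ℤ) * ((2 ^ (2 * k) : ℕ) : ℤ) := by
    rw [← Nat.cast_mul, ← Nat.cast_mul, ← pow_add, ← pow_add]
    congr 2
    omega
  rw [smul_smul, h, mul_smul, hc, smul_zero]

/-- Every class of `H¹(K, E[N])` is killed by `N` (written `((N : ℕ) : ℤ) • y = 0`). [folklore] -/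
theorem natCast_level_zsmul_galH1Torsion_eq_zero {F : Type*} [Field F] (V : WeierstrassCurve F) {N : ℕ}
    (y : galH1Torsion V ((N : ℕ) : ℤ)) : ((N : ℕ) : ℤ) • y = 0 := by
  rw [natCast_zsmul]
  exact nsmul_continuousCohomology_one_eq_zero _ N (fun (T : V.geomTorsion ((N : ℕ) : ℤ)) ↦ AddSubgroup.torsionBy.nsmul T) y

/-- **`τ_* (2^j c_L(n)) = ε_n • (2^j c_L(n))`**, `ε_n = −w(E)·(−1)^{#primes of n}` — Gross Prop. 5.4 at `2` (gk2-p3's unconditional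
`KolyvaginClassSign.sign_conjAct_kolyvaginClass_two`) moved to a multiple of the class.  (The same statement as
`conjAct_zsmul_kolyvaginClass_two` of `…RTRungSupplyKolyvagin`, restated here to keep this file out of the route file's import cone.)
[cite: GrossLMS1991, §5 Prop. 5.4] -/
theorem conjAct_two_pow_zsmul_kolyvaginClass_eq_sign_smul [NeZero (W.conductorNorm ℤ)]
    (Dt : ModularParametrizationData W (W.conductorNorm ℤ)) (β : ℤ) (ι : K →+* ℂ)
    (hK : IsImaginaryQuadratic K) (hne3 : NumberField.discr K ≠ -3) (hne4 : NumberField.discr K ≠ -4)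
    (hodd' : Odd (NumberField.discr K)) (hH : SatisfiesHeegnerHypothesis (W.conductorNorm ℤ) K)
    (hsurj : W.HasSurjectiveModNGaloisRep ((2 : ℤ) ^ 1)) (τ : K ≃ₐ[ℚ] K) (hτ : τ ≠ 1)
    {n : ℕ} (hn : Squarefree n) {L : ℕ} (hL : 1 ≤ L)
    (hKol : ∀ ℓ ∈ n.primeFactors, Zhang2014.IsKolyvaginPrime (W.conductorNorm ℤ) W K 2 ℓ ∧ L ≤ Zhang2014.kolyvaginIndex W 2 ℓ)
    (d : KolyvaginHeegnerData Dt β ι n) (j : ℕ) :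
    conjAct W τ ((2 ^ L : ℕ) : ℤ) (((2 ^ j : ℕ) : ℤ) • d.kolyvaginClass Nat.prime_two L) =
      (-W.rootNumber * (-1) ^ n.primeFactors.card) • (((2 ^ j : ℕ) : ℤ) • d.kolyvaginClass Nat.prime_two L) := by
  rw [map_zsmul, (KolyvaginClassSign.sign_conjAct_kolyvaginClass_two hK hne3 hne4 hodd' hH hsurj τ hτ Dt β ι hn hL hKol d).2,
    smul_comm]

/-- **X-ORTH INSTANTIATED ON A KOLYVAGIN CLASS, ordered form.**  On L_T's habitat over the Heegner field (`W/ℚ` globally minimal,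
`Δ < 0`, odd Tamagawa product, `ρ̄_{E,2}` onto; `K` imaginary quadratic, `d_K` odd `≠ −3`, Heegner for `N_W`; `τ ≠ 1`), at the
Cassels–Tate level `m = 2^k` (`k ≥ 1`) with class level `2^L`, `L = 2k`, a Weil datum `e` on `E[2^L]` (level written `2^k·2^k`) equivariant
under every lift of every `σ ∈ Aut(K/ℚ)`, and local invariants `inv` (conj-compatible, reciprocity, `Ш³ = 0`, finite support — e.g. the
canonical ones): let `z = 2^{L−e₁} • c_L(n)` (`n` square-free, every `ℓ ∣ n` Zhang–Kolyvagin with `L ≤ M(ℓ)` and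
`FrobEqFrobInfty W K (2^L) ℓ`, `e₁ ≤ k`) be Selmer and locally zero at the places over `n`; let `t` be Selmer with `2^k • t = 0`, locally zero
at the places over a square-free `n′` of Zhang–Kolyvagin primes with `L ≤ M(ℓ)`, and `τ_* t = −(ε_n • t)` for `ε_n = −w(E)(−1)^{#n}` (the
sign of `c_L(n)`, Gross Prop. 5.4).  Then for `x, x′ ∈ Ш(E_K)[2^k]` over `z, t`: `B_{2^k}(x, x′) = 0`.
[cite: McCallumLMS1991, §4 Lemma 4.3, Prop. 4.7, §5 Lemma 5.3, Thm. 5.4] [cite: GrossLMS1991, Prop. 5.4, Prop. 6.2 (1)]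
[cite: MilneADT2006, Ch. I §6, proof of Prop. 6.9] [cite: DokchitserDokchitserMathZ2012, Theorem (1)] -/
theorem ctLevelPairing_eq_zero_of_kolyvaginClass_of_opposite_sign [NeZero (W.conductorNorm ℤ)]
    (hK : IsImaginaryQuadratic K) (hΔ : W.Δ < 0) (hodd' : Odd (NumberField.discr K)) (hne3 : NumberField.discr K ≠ -3)
    (hH : SatisfiesHeegnerHypothesis (W.conductorNorm ℤ) K) (hodd : Odd W.tamagawaProduct)
    (hρ2 : W.HasSurjectiveModNGaloisRep 2) {τ : K ≃ₐ[ℚ] K} (hτ1 : τ ≠ 1)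
    (Dt : ModularParametrizationData W (W.conductorNorm ℤ)) (β : ℤ) (ι : K →+* ℂ)
    {L k : ℕ} (hLk : L = 2 * k) (hk1 : 1 ≤ k) [NeZero (2 ^ k)] [NeZero (2 ^ k * 2 ^ k)]
    (e : (W.baseChange K).geomTorsion ((2 ^ k * 2 ^ k : ℕ) : ℤ) → (W.baseChange K).geomTorsion ((2 ^ k * 2 ^ k : ℕ) : ℤ) →
      AlgebraicClosure K)
    (hμ : ∀ S T, e S T ^ (2 ^ k * 2 ^ k) = 1)
    (hadd₁ : ∀ S₁ S₂ T, e (S₁ + S₂) T = e S₁ T * e S₂ T)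
    (hadd₂ : ∀ S T₁ T₂, e S (T₁ + T₂) = e S T₁ * e S T₂)
    (hgal : ∀ (γ : absoluteGaloisGroup K) (S T : (W.baseChange K).geomTorsion ((2 ^ k * 2 ^ k : ℕ) : ℤ)),
      γ • e S T = e (γ • S) (γ • T))
    (halt : ∀ T, e T T = 1)
    (hlift : ∀ (σ : K ≃ₐ[ℚ] K) (τ' : AlgebraicClosure K ≃+* AlgebraicClosure K) (hτ' : IsLiftOfAut σ τ')
      (S T : (W.baseChange K).geomTorsion ((2 ^ k * 2 ^ k : ℕ) : ℤ)),
      τ' (e S T) = e (hτ'.torsionMap W ((2 ^ k * 2 ^ k : ℕ) : ℤ) S) (hτ'.torsionMap W ((2 ^ k * 2 ^ k : ℕ) : ℤ) T))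
    (inv : LocalInvariants K (2 ^ k * 2 ^ k)) (hinvc : inv.IsConjCompatible τ) (hPT' : inv.SumInvLocalizationEqZero)
    (hH3 : ∀ c₃ : galoisCohomology (DiscreteGaloisModule.mu K (2 ^ k * 2 ^ k)) 3,
      (∀ v : Place K, galoisCohomology.localization (DiscreteGaloisModule.mu K (2 ^ k * 2 ^ k)) v 3 c₃ = 0) → c₃ = 0)
    (hfin : ∀ D : GeneralCaseData (W.baseChange K) (2 ^ k) e hμ hadd₁ hadd₂ hgal,
      ∃ S : Finset (Place K), ∀ v ∉ S, D.localTerm inv v = 0)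
    -- the first class: a Kolyvagin class with provenance
    {n : ℕ} (hn : Squarefree n)
    (hKol : ∀ ℓ ∈ n.primeFactors, Zhang2014.IsKolyvaginPrime (W.conductorNorm ℤ) W K 2 ℓ ∧
      L ≤ Zhang2014.kolyvaginIndex W 2 ℓ ∧ FrobEqFrobInfty W K (2 ^ L) ℓ)
    (d : KolyvaginHeegnerData Dt β ι n) {e₁ : ℕ} (he₁ : e₁ ≤ k)
    (hzS : ((2 ^ (L - e₁) : ℕ) : ℤ) • d.kolyvaginClass Nat.prime_two L ∈ selmerGroup (W.baseChange K) ((2 ^ L : ℕ) : ℤ))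
    (hzloc : ∀ ℓ ∈ n.primeFactors, ∀ v : HeightOneSpectrum (𝓞 K), (ℓ : 𝓞 K) ∈ v.asIdeal →
      ((2 ^ (L - e₁) : ℕ) : ℤ) • d.kolyvaginClass Nat.prime_two L ∈
        (W.baseChange K).torsionLocalKer (v.adicCompletion K) ((2 ^ L : ℕ) : ℤ))
    -- the second class
    {t : galH1Torsion (W.baseChange K) ((2 ^ L : ℕ) : ℤ)} (htS : t ∈ selmerGroup (W.baseChange K) ((2 ^ L : ℕ) : ℤ))
    (hkt : ((2 ^ k : ℕ) : ℤ) • t = 0)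
    {n' : ℕ} (hn' : Squarefree n')
    (hKol' : ∀ ℓ ∈ n'.primeFactors, Zhang2014.IsKolyvaginPrime (W.conductorNorm ℤ) W K 2 ℓ ∧ L ≤ Zhang2014.kolyvaginIndex W 2 ℓ)
    (htloc : ∀ ℓ ∈ n'.primeFactors, ∀ v : HeightOneSpectrum (𝓞 K), (ℓ : 𝓞 K) ∈ v.asIdeal →
      t ∈ (W.baseChange K).torsionLocalKer (v.adicCompletion K) ((2 ^ L : ℕ) : ℤ))
    (hst : conjAct W τ ((2 ^ L : ℕ) : ℤ) t = -((-W.rootNumber * (-1) ^ n.primeFactors.card) • t))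
    -- the Ш-classes over them
    (x x' : ((W.baseChange K).sha)[((2 ^ k : ℕ) : ℤ)])
    (hx : shaTorsionVal (W.baseChange K) (2 ^ k) x =
      torsionH1ToH1 (W.baseChange K) ((2 ^ L : ℕ) : ℤ) (((2 ^ (L - e₁) : ℕ) : ℤ) • d.kolyvaginClass Nat.prime_two L))
    (hx' : shaTorsionVal (W.baseChange K) (2 ^ k) x' = torsionH1ToH1 (W.baseChange K) ((2 ^ L : ℕ) : ℤ) t) :
    ctLevelPairing (W.baseChange K) (2 ^ k) e hμ hadd₁ hadd₂ hgal inv halt hPT' hH3 hfin x x' = 0 := by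
  haveI hell : (W.baseChange K).IsElliptic := inferInstanceAs ((W.map (algebraMap ℚ K)).IsElliptic)
  haveI : Fact (Nat.Prime 2) := ⟨Nat.prime_two⟩
  have hne4 : NumberField.discr K ≠ -4 := fun h ↦ by
    rw [h] at hodd'
    exact (Int.not_even_iff_odd.mpr hodd') ⟨-2, by norm_num⟩
  have hsurj1 : W.HasSurjectiveModNGaloisRep ((2 : ℤ) ^ 1) := by rwa [pow_one]
  have hL1 : 1 ≤ L := by omega
  have hL0 : (2 ^ L : ℕ) ≠ 0 := pow_ne_zero _ two_ne_zero
  have hNm : 2 ^ L = 2 ^ k * 2 ^ k := by subst hLk; rw [two_mul, pow_add]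
  have hττ : τ * τ = 1 := mul_self_eq_one_of_isImaginaryQuadratic hK τ
  have hKol₂ : ∀ ℓ ∈ n.primeFactors, Zhang2014.IsKolyvaginPrime (W.conductorNorm ℤ) W K 2 ℓ ∧
      L ≤ Zhang2014.kolyvaginIndex W 2 ℓ := fun ℓ hℓ ↦ ⟨(hKol ℓ hℓ).1, (hKol ℓ hℓ).2.1⟩
  -- no `Γ_K`-fixed point in `E[2^k]`: `E(K)[2] = 0`
  have h2K : ∀ P : (W.baseChange K).toAffine.Point, 2 • P = 0 → P = 0 :=
    forall_two_nsmul_baseChange_of_hasSurjectiveModNGaloisRep_two_of_isImaginaryQuadratic W hρ2 K hK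
  have hnofix : ∀ P : geomTorsion (W.baseChange K) ((2 ^ k : ℕ) : ℤ), (∀ g : absoluteGaloisGroup K, g • P = P) → P = 0 :=
    fun P hP ↦ VisiblePairAtTwo.geomTorsion_fixed_eq_zero_of_forall_two_nsmul (W.baseChange K) h2K k P hP
  -- the abstract data: `c = c_L(n)`, `k′ = 2^{k−e₁}`, `s = ε_n`, `Sn` / `Sn′` the places over `n` / `n′`
  set c := d.kolyvaginClass Nat.prime_two L with hcdef
  have hz : ((2 ^ (L - e₁) : ℕ) : ℤ) • c = ((2 ^ k : ℕ) : ℤ) • (((2 ^ (k - e₁) : ℕ) : ℤ) • c) := by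
    rw [smul_smul, ← natCast_two_pow_sub_eq_mul hLk he₁]
  have hsc : conjAct W τ ((2 ^ L : ℕ) : ℤ) (((2 ^ (k - e₁) : ℕ) : ℤ) • c) =
      (-W.rootNumber * (-1) ^ n.primeFactors.card) • (((2 ^ (k - e₁) : ℕ) : ℤ) • c) :=
    conjAct_two_pow_zsmul_kolyvaginClass_eq_sign_smul W K Dt β ι hK hne3 hne4 hodd' hH hsurj1 τ hτ1 hn hL1 hKol₂ d (k - e₁)
  refine ctLevelPairing_eq_zero_of_opposite_signs_of_level_eq W K hNm hNm.symm hK hΔ hL1 hτ1 hττ e hμ hadd₁ hadd₂ hgal halt inv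
    hinvc hPT' hH3 hfin hnofix x x' hzS htS hx hx' (((2 ^ (k - e₁) : ℕ) : ℤ)) hz hkt hsc hst
    {q | ((n : ℕ) : 𝓞 K) ∈ q.asIdeal} {q | ((n' : ℕ) : 𝓞 K) ∈ q.asIdeal} ?_ ?_ ?_ ?_ ?_
  · -- `c_L(n)` is Selmer off `n` at every place (Gross Prop. 6.2 (1), odd Tamagawa; complex places)
    intro v hv
    rcases v with w | q
    · rw [selmerLocalKer_completion_inl]
      exact mem_selmerLocalKer_infinitePlace_of_isImaginaryQuadratic hK _ w _
    · rw [selmerLocalKer_completion_inr]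
      exact P2.TamagawaSelmerAtTwo.kolyvaginClass_mem_selmerLocalKer_two_pow_of_not_mem d hK hH hodd hn.ne_zero L q
        fun h ↦ hv q h rfl
  · -- `2^k • loc_q (2^{k−e₁} c) = loc_q z = 0` at the places over `n`
    intro q hq
    obtain ⟨ℓ, hℓ, hℓq⟩ := (JET.SelmerVocabulary.natCast_mem_iff_exists_primeFactor_mem hn.ne_zero q).mp hq
    haveI : CharZero (q.adicCompletion K) := charZero_of_injective_algebraMap (algebraMap K (q.adicCompletion K)).injective
    have h := (mem_torsionLocalKer_iff_res_eq_zero (W.baseChange K) (q.adicCompletion K) hL0 _).mp (hzloc ℓ hℓ q hℓq)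
    rw [hz] at h
    exact (map_zsmul _ _ _).symm.trans h
  · -- `loc_q t = 0` at the places over `n′`
    intro q hq
    obtain ⟨ℓ, hℓ, hℓq⟩ := (JET.SelmerVocabulary.natCast_mem_iff_exists_primeFactor_mem hn'.ne_zero q).mp hq
    haveI : CharZero (q.adicCompletion K) := charZero_of_injective_algebraMap (algebraMap K (q.adicCompletion K)).injective
    exact (mem_torsionLocalKer_iff_res_eq_zero (W.baseChange K) (q.adicCompletion K) hL0 _).mp (htloc ℓ hℓ q hℓq)
  · -- `E[2^L] ⊂ E(K_q)` at the places over `n′` (index `≥ L`)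
    intro q hq g Q
    obtain ⟨ℓ, hℓ, hℓq⟩ := (JET.SelmerVocabulary.natCast_mem_iff_exists_primeFactor_mem hn'.ne_zero q).mp hq
    exact galoisRep_toLocal_apply_eq_self W K hK (hKol' ℓ hℓ).1 (hKol' ℓ hℓ).2 q hℓq g Q
  · -- the places over `n` are deep inert Kolyvagin places carrying the lift-equivariance of `e`
    intro q hq _
    obtain ⟨ℓ, hℓ, hℓq⟩ := (JET.SelmerVocabulary.natCast_mem_iff_exists_primeFactor_mem hn.ne_zero q).mp hq
    have hfix : τ • q = q := smul_place_eq_of_zhangKolyvaginPrime W K (hKol ℓ hℓ).1 τ hℓq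
    exact ⟨ℓ, hfix, (hKol ℓ hℓ).1, (hKol ℓ hℓ).2.1, (hKol ℓ hℓ).2.2, hℓq,
      fun S T ↦ (hlift τ _ (isLiftOfAut_liftAutPlace τ hfix) S T).symm⟩

end Ordered

end Summit.BirchSwinnertonDyer.BirchSwinnertonDyer.Theorems.GenusExact.PlusDescent

end
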